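import Literature.Probability.Percolation.TriBlockCrossing
import Literature.Probability.Percolation.TriRSWChaining
import HarnessLib

/-!
# Iterating the block inequality: `100 · P_p(LR(a_k, 2a_k)) ≤ (100 · P_p(LR(a₀, 2a₀)))^{2^k}` (proofs only)

Topic `Literature/Probability/Percolation`; family `crit-perc`. The iteration step of Nolin 2008,
§7.4, proof of Lemma 39 [arXiv 0711.4948: Lemma 37], eq. (7.22): "We then obtain by iterating:
`C' P_p(𝒞_H([0, 2^k L(p)] × [0, 2^{k+1} L(p)])) ≤ (C' ε₁)^{2^k}` as soon as
`ε₁ ≥ P_p(𝒞_H([0, L(p)] × [0, 2 L(p)]))`", in the lattice form of `TriBlockCrossing.lean`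
(`C' = 10²`, scales `a_{k+1} = 2 a_k + 1`, i.e. `a_k + 1 = 2^k (a₀ + 1)`), together with the
comparison of crossings of parallelograms of different widths used in the last step of that
proof ("`P_p(𝒞_H([0, n] × [0, n])) ≤ P_p(𝒞_H([0, 2^k L(p)] × [0, 2^{k+1} L(p)]))`"):

* `triLRCrossingProb_square_le_easy` — `P_p(LR(n, n)) ≤ P_p(LR(a, 2a))` for `a ≤ n ≤ 2a`
  (anti-monotonicity in the width, `triLRCrossingProb_anti_width` of `TriRSWChaining.lean`, and
  monotonicity in the height, `triLRCrossingProb_mono_height` of `TriShiftedCrossings.lean`);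
* `triLRCrossingProb_block_iterate` — **(7.22)**:
  `100 · P_p(LR(2^k (a₀+1) - 1, 2 (2^k (a₀+1) - 1))) ≤ (100 · P_p(LR(a₀, 2a₀)))^{2^k}` for `a₀ ≥ 1`.

## References

* P. Nolin, *Electron. J. Probab.* 13 (2008), §7.4, Lemma 39, eqs. (7.21)–(7.22) (arXiv
  0711.4948: Lemma 37) [Nolin2008].
-/

noncomputable section

open MeasureTheory Set
open scoped unitInterval

namespace Literature.Probability.Percolation


/-- **Squares versus easy blocks**: for `a ≤ n ≤ 2a`, `P_p(LR(n, n)) ≤ P_p(LR(a, 2a))` (narrower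
and taller is easier; last step of the proof of Nolin's Lemma 39). [cite: Nolin2008, §7.4, Lemma 39 (proof, last display; arXiv 0711.4948: Lemma 37)] -/
theorem triLRCrossingProb_square_le_easy (p : unitInterval) {a n : ℕ} (h₁ : a ≤ n) (h₂ : n ≤ 2 * a) :
    triLRCrossingProb p n n ≤ triLRCrossingProb p a (2 * a) :=
  (triLRCrossingProb_anti_width p h₁ n).trans (triLRCrossingProb_mono_height p a h₂)

/-- The block scales: `a_k + 1 = 2^k (a₀ + 1)`, so `a_{k+1} = 2 a_k + 1`. [folklore] -/
theorem blockScale_succ (a₀ k : ℕ) :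
    2 ^ (k + 1) * (a₀ + 1) - 1 = 2 * (2 ^ k * (a₀ + 1) - 1) + 1 := by
  have : 1 ≤ 2 ^ k * (a₀ + 1) := Nat.one_le_iff_ne_zero.2 (by positivity)
  rw [pow_succ, mul_comm (2 ^ k) 2, mul_assoc]
  omega

/-- **Iterating the block inequality** (Nolin 2008, proof of Lemma 39, eq. (7.22)): with
`a_k = 2^k (a₀ + 1) - 1` (`a₀ ≥ 1`), `100 · P_p(LR(a_k, 2a_k)) ≤ (100 · P_p(LR(a₀, 2a₀)))^{2^k}`,
by induction from `triLRCrossingProb_block_le` (`u_{k+1} ≤ u_k²` for `u_k = 100 P_p(LR(a_k, 2a_k))`). [cite: Nolin2008, §7.4, Lemma 39 (proof, eq. (7.22); arXiv 0711.4948: Lemma 37)] -/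
theorem triLRCrossingProb_block_iterate (p : unitInterval) {a₀ : ℕ} (ha₀ : 1 ≤ a₀) (k : ℕ) :
    100 * triLRCrossingProb p (2 ^ k * (a₀ + 1) - 1) (2 * (2 ^ k * (a₀ + 1) - 1)) ≤
      (100 * triLRCrossingProb p a₀ (2 * a₀)) ^ (2 ^ k) := by
  induction k with
  | zero => simp
  | succ k ih =>
    have hak : 1 ≤ 2 ^ k * (a₀ + 1) - 1 := by
      have : a₀ + 1 ≤ 2 ^ k * (a₀ + 1) := Nat.le_mul_of_pos_left _ (by positivity)
      omega
    have hstep := triLRCrossingProb_block_le p hak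
    have hshape : 2 ^ (k + 1) * (a₀ + 1) - 1 = 2 * (2 ^ k * (a₀ + 1) - 1) + 1 := blockScale_succ a₀ k
    have hshape2 : 2 * (2 ^ (k + 1) * (a₀ + 1) - 1) = 4 * (2 ^ k * (a₀ + 1) - 1) + 2 := by
      rw [hshape]; ring
    rw [hshape2, hshape, pow_succ, pow_mul]
    have h0 : 0 ≤ 100 * triLRCrossingProb p (2 ^ k * (a₀ + 1) - 1) (2 * (2 ^ k * (a₀ + 1) - 1)) := by
      have := (triLRCrossingProb_mem_Icc p (2 ^ k * (a₀ + 1) - 1) (2 * (2 ^ k * (a₀ + 1) - 1))).1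
      positivity
    calc 100 * triLRCrossingProb p (2 * (2 ^ k * (a₀ + 1) - 1) + 1) (4 * (2 ^ k * (a₀ + 1) - 1) + 2)
        ≤ 100 * (100 * triLRCrossingProb p (2 ^ k * (a₀ + 1) - 1) (2 * (2 ^ k * (a₀ + 1) - 1)) ^ 2) :=
          mul_le_mul_of_nonneg_left hstep (by norm_num)
      _ = (100 * triLRCrossingProb p (2 ^ k * (a₀ + 1) - 1) (2 * (2 ^ k * (a₀ + 1) - 1))) ^ 2 := by ring
      _ ≤ ((100 * triLRCrossingProb p a₀ (2 * a₀)) ^ 2 ^ k) ^ 2 := pow_le_pow_left₀ h0 ih 2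

end Literature.Probability.Percolation
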